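import Summits.AtomisticToContinuum.Crystallization.Theses.OneCentreSteepnessLadder
import Literature.MathematicalPhysics.StatisticalMechanics.Yuhjtman2015Proofs

/-!
# TargetAssembly — glue for the target of route OneCentreSteepnessLadder

Closes item stmt-AtomisticToContinuum-14453 (`TargetAssembly`): the implication
`LJDominationTwoThirds → OneCentreDominationLJ`.  Take `δ := 2/3`; the separation half of the
target — every Lennard-Jones ground state is `(2/3)`-separated — is the PROVED Literature theorem
`Yuhjtman2015_minDistance_holds` (Yuhjtman 2015, Cor. 7: all interparticle distances of an optimal
Lennard-Jones cluster exceed `0.684 > 2/3`); the domination half is the hypothesis verbatim.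
-/

namespace Summit.AtomisticToContinuum.Crystallization.Theorems

open Summit.AtomisticToContinuum.Crystallization.Theses.OneCentreSteepnessLadder

/-- **Target assembly** (item stmt-AtomisticToContinuum-14453).  Coercive one-centre domination at
exponent `6` over `(2/3)`-separated point sets (`LJDominationTwoThirds`, scale `(a, h)`) gives the
target `OneCentreDominationLJ` with the witness `(δ, a, h) := (2/3, a, h)`: the numerical side
conditions are those of the hypothesis, the domination clause is the hypothesis itself, and the
`(2/3)`-separation of Lennard-Jones ground states follows from Yuhjtman's bound
`dist (x i) (x j) > 0.684` (`Yuhjtman2015_minDistance_holds`, Yuhjtman 2015, Cor. 7) since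
`2/3 < 0.684`. -/
theorem targetAssembly_proof : TargetAssembly := by
  unfold TargetAssembly
  rintro ⟨a, h, ha, hh, hw₁, hw₂, hdom⟩
  refine ⟨2 / 3, a, h, by norm_num, ha, hh, hw₁, hw₂, ?_, hdom⟩
  intro N x hx i j hij
  have hY :=
    Literature.MathematicalPhysics.StatisticalMechanics.Yuhjtman2015_minDistance_holds N x hx i j hij
  have h23 : (2 / 3 : ℝ) ≤ 0.684 := by norm_num
  exact h23.trans hY.le

end Summit.AtomisticToContinuum.Crystallization.Theorems
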